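import Summits.CriticalPhenomena.SAWScalingLimit.Theorems.FKGToTraversalBound.Negative.DeepEndpointGap
import Summits.CriticalPhenomena.SAWScalingLimit.Theorems.LeftRightFKG.Negative.OrderCharacterisation
import Literature.Probability.LatticeModels.LatticeDobrushinBox

/-!
# The `3 × 3` box as `Ω(C) = {wind(C, ·) ≠ 0}` for the boundary walk of `[-1,3]²`
(crux `NotFKGAtOne`, line `three-by-three-corner-witness`, stub `stub_windBox`)

Crux `stmt-CriticalPhenomena-11233`
(`Summit.CriticalPhenomena.SAWScalingLimit.Theses.SAWLeftRightFKG.NotFKGAtOne`: left–right positive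
association fails for the COUNTING measure on the chords of some lattice domain), line
`three-by-three-corner-witness` (skeleton `Cruxes/NotFKGAtOne/Lines/three_by_three_corner_witness.lean`),
registered stub `stub_windBox` — the analytic identification of the witness domain.

**`stub_windBox`**: for ANY closed walk `C` of `ℤ²` based at the corner `c₀ = (-1,-1)` whose support (minus
its head `c₀`) is the counter-clockwise boundary cycle of the lattice square `[-1,3]²` (an explicit list of
16 sites), the open square `(-1,3)²` lies in the crux's domain `dom C 1 = {z | wind(C₁ − z) ≠ 0}` (`C₁` the
mesh-`1` polyline of `C`, `Set.IccExtend` of `SimpleGraph.Walk.toCurve`), and the mesh-`1` lattice points of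
`dom C 1` are exactly the box `{0,1,2}² = boxSites (0,0) (2,2)`.

Proof: a line-by-line replay of the landed `LeftRightFKG/Negative/BoxDomain.lean` (`Rint_subset_Ωb`,
`meshVertices_Ωb`, written there for the `5 × 4` box and its boundary walk `Cwalk`) at `3 × 3`, the concrete
polyline now being supplied by the support hypothesis: the crux's loop is `(poly c₀ C.support.tail).extend`
(`iccExtend_toCurve_apply`); inside the open square the winding number is `1` (crossing formula
`wind_poly_probeL` at the face `(0,0)`, where the signed crossing count of the explicit cycle is `-1` by
`decide`, transported through the convex open square, which misses the trace, by
`wind_sub_eq_of_mem_connectedComponentIn`); the lattice points of the boundary are vertices of `C`, where the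
winding number has the junk value `0` (`notMem_dom_of_mem_support`); outside the closed square it is `0`
(`wind_poly_eq_zero_far` with the escape rays `exists_far_re_gt/lt`, `exists_far_im_gt/lt`).  Elementary
plane topology of lattice polygons ("folklore"); the file contains no definitions (the winding lemmas are
stated for any closed walk at `c₀` satisfying the five decidable side conditions, discharged by `decide`
for the explicit cycle in `stub_windBox`; `boxSites` is `Literature.Probability.LatticeModels.LatticeDobrushinBox`).
-/

noncomputable section

open Real Set Complex Literature.Probability.LatticeModels Literature.Probability.RandomPlanarGeometry
  Literature.Topology.PlaneTopology
open Summit.CriticalPhenomena.SAWScalingLimit.Theorems.LeftRightFKG.Negative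
open Summit.CriticalPhenomena.SAWScalingLimit.Theorems.FKGToTraversalBound.Negative (dom notMem_dom_of_mem_support)

namespace Summit.CriticalPhenomena.SAWScalingLimit.Theorems.NotFKGAtOne

/-! ## The open square `(-1,3)²`, the closed square `[-1,3]²`, the four boundary lines -/

/-- The open square `(-1,3)²` is convex. [folklore] -/
theorem convex_Rint₃ : Convex ℝ {z : ℂ | (-1 < z.re ∧ z.re < 3) ∧ (-1 < z.im ∧ z.im < 3)} := by
  have h : {z : ℂ | (-1 < z.re ∧ z.re < 3) ∧ (-1 < z.im ∧ z.im < 3)} =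
      ({z : ℂ | (-1 : ℝ) < z.re} ∩ {z : ℂ | z.re < 3}) ∩ ({z : ℂ | (-1 : ℝ) < z.im} ∩ {z : ℂ | z.im < 3}) := by
    ext z; simp only [Set.mem_inter_iff, Set.mem_setOf_eq]
  rw [h]
  exact ((convex_halfSpace_re_gt _).inter (convex_halfSpace_re_lt _)).inter
    ((convex_halfSpace_im_gt _).inter (convex_halfSpace_im_lt _))

/-- The open square `(-1,3)²` is open. [folklore] -/
theorem isOpen_Rint₃ : IsOpen {z : ℂ | (-1 < z.re ∧ z.re < 3) ∧ (-1 < z.im ∧ z.im < 3)} := by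
  have h : {z : ℂ | (-1 < z.re ∧ z.re < 3) ∧ (-1 < z.im ∧ z.im < 3)} =
      ({z : ℂ | (-1 : ℝ) < z.re} ∩ {z : ℂ | z.re < 3}) ∩ ({z : ℂ | (-1 : ℝ) < z.im} ∩ {z : ℂ | z.im < 3}) := by
    ext z; simp only [Set.mem_inter_iff, Set.mem_setOf_eq]
  rw [h]
  exact ((isOpen_lt continuous_const Complex.continuous_re).inter
    (isOpen_lt Complex.continuous_re continuous_const)).inter
    ((isOpen_lt continuous_const Complex.continuous_im).inter
    (isOpen_lt Complex.continuous_im continuous_const))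

/-- The closed square `[-1,3]²` is convex. [folklore] -/
theorem convex_Rcl₃ : Convex ℝ {z : ℂ | (-1 ≤ z.re ∧ z.re ≤ 3) ∧ (-1 ≤ z.im ∧ z.im ≤ 3)} := by
  have h : {z : ℂ | (-1 ≤ z.re ∧ z.re ≤ 3) ∧ (-1 ≤ z.im ∧ z.im ≤ 3)} =
      ({z : ℂ | (-1 : ℝ) ≤ z.re} ∩ {z : ℂ | z.re ≤ 3}) ∩ ({z : ℂ | (-1 : ℝ) ≤ z.im} ∩ {z : ℂ | z.im ≤ 3}) := by
    ext z; simp only [Set.mem_inter_iff, Set.mem_setOf_eq]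
  rw [h]
  exact ((convex_halfSpace_re_ge _).inter (convex_halfSpace_re_le _)).inter
    ((convex_halfSpace_im_ge _).inter (convex_halfSpace_im_le _))

/-- The closed square `[-1,3]²` is closed. [folklore] -/
theorem isClosed_Rcl₃ : IsClosed {z : ℂ | (-1 ≤ z.re ∧ z.re ≤ 3) ∧ (-1 ≤ z.im ∧ z.im ≤ 3)} := by
  have h : {z : ℂ | (-1 ≤ z.re ∧ z.re ≤ 3) ∧ (-1 ≤ z.im ∧ z.im ≤ 3)} =
      ({z : ℂ | (-1 : ℝ) ≤ z.re} ∩ {z : ℂ | z.re ≤ 3}) ∩ ({z : ℂ | (-1 : ℝ) ≤ z.im} ∩ {z : ℂ | z.im ≤ 3}) := by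
    ext z; simp only [Set.mem_inter_iff, Set.mem_setOf_eq]
  rw [h]
  exact ((isClosed_le continuous_const Complex.continuous_re).inter
    (isClosed_le Complex.continuous_re continuous_const)).inter
    ((isClosed_le continuous_const Complex.continuous_im).inter
    (isClosed_le Complex.continuous_im continuous_const))

/-- The four boundary lines miss the open square. [folklore] -/
theorem Cbd₃_subset_compl_Rint₃ :
    {z : ℂ | z.im = -1 ∨ z.re = 3 ∨ z.im = 3 ∨ z.re = -1} ⊆
      {z : ℂ | (-1 < z.re ∧ z.re < 3) ∧ (-1 < z.im ∧ z.im < 3)}ᶜ := by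
  intro z hz hR
  simp only [mem_setOf_eq] at hz
  obtain ⟨⟨h1, h2⟩, h3, h4⟩ := hR
  rcases hz with h | h | h | h <;> linarith

/-- The centre of the face `(0,0)` lies in the open square. [folklore] -/
theorem probeL00_mem_Rint₃ : probeL 0 0 ∈ {z : ℂ | (-1 < z.re ∧ z.re < 3) ∧ (-1 < z.im ∧ z.im < 3)} := by
  simp only [mem_setOf_eq, probeL_re, probeL_im]; norm_num

/-- A unit segment whose endpoints lie on a common side of `[-1,3]²` lies on the boundary lines. [folklore] -/
theorem segment_subset_Cbd₃ {p q : Site 2} (h : (p 1 = -1 ∧ q 1 = -1) ∨ (p 0 = 3 ∧ q 0 = 3) ∨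
      (p 1 = 3 ∧ q 1 = 3) ∨ (p 0 = -1 ∧ q 0 = -1)) :
    segment ℝ (pt p) (pt q) ⊆ {z : ℂ | z.im = -1 ∨ z.re = 3 ∨ z.im = 3 ∨ z.re = -1} := by
  intro z hz
  simp only [mem_setOf_eq]
  rcases h with ⟨hp, hq⟩ | ⟨hp, hq⟩ | ⟨hp, hq⟩ | ⟨hp, hq⟩
  · left; rw [im_eq_of_mem_segment (by rw [hp, hq]) hz, hp]; norm_num
  · right; left; rw [re_eq_of_mem_segment (by rw [hp, hq]) hz, hp]; norm_num
  · right; right; left; rw [im_eq_of_mem_segment (by rw [hp, hq]) hz, hp]; norm_num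
  · right; right; right; rw [re_eq_of_mem_segment (by rw [hp, hq]) hz, hp]; norm_num

/-! ## Winding numbers of a closed walk at `c₀` running along the sides of `[-1,3]²`

The hypotheses of this section (crossing count `-1` at the face `(0,0)`, heights `≤ 3`, consecutive
vertices on a common side, vertices in the closed square, every boundary lattice point a vertex) are
decided by `decide` for the explicit boundary cycle in `stub_windBox`. -/

section Cycle

variable (C : (zdGraph 2).Walk c₀ c₀)

/-- **A closed walk with crossing count `-1` winds once round the centre of the face `(0,0)`.** [folklore] -/
theorem wind_cycle_probe (hpc : pathCross 0 0 c₀ C.support.tail = -1)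
    (hle : ∀ x ∈ C.support.tail, x 1 ≤ 3) :
    wind (fun t : ℝ => (poly c₀ C.support.tail).extend t - probeL 0 0) = 1 := by
  have h := wind_poly_probeL (m := 0) (k := 0) (Y := 3) (by norm_num) c₀ C.support.tail
    (isChain_support (fun _ _ h => h) C) (by decide) hle (poly_fst_walk C)
  rw [hpc] at h
  push_cast at h
  simp only [neg_neg] at h
  exact_mod_cast h

/-- The trace of a walk along the sides lies on the four boundary lines. [folklore] -/
theorem range_cycle_subset_Cbd₃
    (hbd : List.IsChain (fun p q : Site 2 => (p 1 = -1 ∧ q 1 = -1) ∨ (p 0 = 3 ∧ q 0 = 3) ∨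
      (p 1 = 3 ∧ q 1 = 3) ∨ (p 0 = -1 ∧ q 0 = -1)) (c₀ :: C.support.tail)) :
    range (poly c₀ C.support.tail) ⊆ {z : ℂ | z.im = -1 ∨ z.re = 3 ∨ z.im = 3 ∨ z.re = -1} :=
  range_poly_subset_of_isChain c₀ _ (Or.inl (by simp)) (hbd.imp fun _ _ h => segment_subset_Cbd₃ h)

/-- **Inside the open square such a walk winds once.** [folklore] -/
theorem wind_cycle_of_mem_Rint₃ (hpc : pathCross 0 0 c₀ C.support.tail = -1)
    (hle : ∀ x ∈ C.support.tail, x 1 ≤ 3)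
    (hbd : List.IsChain (fun p q : Site 2 => (p 1 = -1 ∧ q 1 = -1) ∨ (p 0 = 3 ∧ q 0 = 3) ∨
      (p 1 = 3 ∧ q 1 = 3) ∨ (p 0 = -1 ∧ q 0 = -1)) (c₀ :: C.support.tail))
    {z : ℂ} (hz : z ∈ {z : ℂ | (-1 < z.re ∧ z.re < 3) ∧ (-1 < z.im ∧ z.im < 3)}) :
    wind (fun t : ℝ => (poly c₀ C.support.tail).extend t - z) = 1 := by
  rw [← wind_cycle_probe C hpc hle]
  symm
  set P := poly c₀ C.support.tail
  have hK : IsClosed {z : ℂ | (-1 < z.re ∧ z.re < 3) ∧ (-1 < z.im ∧ z.im < 3)}ᶜ := isOpen_Rint₃.isClosed_compl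
  have hmaps :
      MapsTo P.extend (Icc 0 1) {z : ℂ | (-1 < z.re ∧ z.re < 3) ∧ (-1 < z.im ∧ z.im < 3)}ᶜ := fun t ht => by
    rw [Path.extend_apply P ht]
    exact Cbd₃_subset_compl_Rint₃ (range_cycle_subset_Cbd₃ C hbd ⟨_, rfl⟩)
  have h01 : P.extend 0 = P.extend 1 := by
    rw [Path.extend_zero, Path.extend_one, poly_fst_walk C]
  refine wind_sub_eq_of_mem_connectedComponentIn P.continuous_extend.continuousOn h01 hK hmaps ?_
  rw [compl_compl]
  exact convex_Rint₃.isPreconnected.subset_connectedComponentIn probeL00_mem_Rint₃ Subset.rfl hz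

/-- The open square lies in the crux's domain `Ω(C) = dom C 1`. [folklore] -/
theorem Rint₃_subset_dom (hpc : pathCross 0 0 c₀ C.support.tail = -1)
    (hle : ∀ x ∈ C.support.tail, x 1 ≤ 3)
    (hbd : List.IsChain (fun p q : Site 2 => (p 1 = -1 ∧ q 1 = -1) ∨ (p 0 = 3 ∧ q 0 = 3) ∨
      (p 1 = 3 ∧ q 1 = 3) ∨ (p 0 = -1 ∧ q 0 = -1)) (c₀ :: C.support.tail)) :
    {z : ℂ | (-1 < z.re ∧ z.re < 3) ∧ (-1 < z.im ∧ z.im < 3)} ⊆ dom C 1 := fun z hz => by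
  simp only [dom, mem_setOf_eq, iccExtend_toCurve_apply, wind_cycle_of_mem_Rint₃ C hpc hle hbd hz]
  norm_num

/-- The trace of a walk with vertices in the closed square lies in the closed square. [folklore] -/
theorem range_cycle_subset_Rcl₃
    (hbx : ∀ x ∈ C.support.tail, (-1 ≤ x 0 ∧ x 0 ≤ 3) ∧ (-1 ≤ x 1 ∧ x 1 ≤ 3)) :
    range (poly c₀ C.support.tail) ⊆ {z : ℂ | (-1 ≤ z.re ∧ z.re ≤ 3) ∧ (-1 ≤ z.im ∧ z.im ≤ 3)} := by
  refine range_poly_subset convex_Rcl₃ c₀ _ (by simp only [mem_setOf_eq, pt_re, pt_im]; norm_num)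
    fun x hx => ?_
  obtain ⟨⟨h1, h2⟩, h3, h4⟩ := hbx x hx
  simp only [mem_setOf_eq, pt_re, pt_im]
  refine ⟨⟨?_, ?_⟩, ?_, ?_⟩ <;> assumption_mod_cast

/-- **Outside the closed square such a walk does not wind.** [folklore] -/
theorem not_mem_dom_of_not_mem_Rcl₃
    (hbx : ∀ x ∈ C.support.tail, (-1 ≤ x 0 ∧ x 0 ≤ 3) ∧ (-1 ≤ x 1 ∧ x 1 ≤ 3)) {z : ℂ}
    (hz : z ∉ {z : ℂ | (-1 ≤ z.re ∧ z.re ≤ 3) ∧ (-1 ≤ z.im ∧ z.im ≤ 3)}) : z ∉ dom C 1 := by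
  simp only [dom, mem_setOf_eq, not_not, iccExtend_toCurve_apply]
  refine wind_poly_eq_zero_far c₀ _ (poly_fst_walk C) isClosed_Rcl₃ (range_cycle_subset_Rcl₃ C hbx)
    hz ?_
  intro M
  have hz' : (z.re < -1 ∨ 3 < z.re) ∨ (z.im < -1 ∨ 3 < z.im) := by
    simp only [mem_setOf_eq, not_and_or, not_le] at hz
    exact hz
  rcases hz' with (h | h) | (h | h)
  · obtain ⟨w, hw, hs⟩ := exists_far_re_lt h M
    exact ⟨w, hw, fun y hy hyK => absurd hyK.1.1 (not_le.2 (hs hy))⟩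
  · obtain ⟨w, hw, hs⟩ := exists_far_re_gt h M
    exact ⟨w, hw, fun y hy hyK => absurd hyK.1.2 (not_le.2 (hs hy))⟩
  · obtain ⟨w, hw, hs⟩ := exists_far_im_lt h M
    exact ⟨w, hw, fun y hy hyK => absurd hyK.2.1 (not_le.2 (hs hy))⟩
  · obtain ⟨w, hw, hs⟩ := exists_far_im_gt h M
    exact ⟨w, hw, fun y hy hyK => absurd hyK.2.2 (not_le.2 (hs hy))⟩

/-- **The mesh vertices of `Ω(C)` are exactly the sites of the `3 × 3` box.** [folklore] -/
theorem meshVertices_dom (hpc : pathCross 0 0 c₀ C.support.tail = -1)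
    (hle : ∀ x ∈ C.support.tail, x 1 ≤ 3)
    (hbd : List.IsChain (fun p q : Site 2 => (p 1 = -1 ∧ q 1 = -1) ∨ (p 0 = 3 ∧ q 0 = 3) ∨
      (p 1 = 3 ∧ q 1 = 3) ∨ (p 0 = -1 ∧ q 0 = -1)) (c₀ :: C.support.tail))
    (hbx : ∀ x ∈ C.support.tail, (-1 ≤ x 0 ∧ x 0 ≤ 3) ∧ (-1 ≤ x 1 ∧ x 1 ≤ 3))
    (hmem : ∀ i j : ℤ, -1 ≤ i → i ≤ 3 → -1 ≤ j → j ≤ 3 → (i = -1 ∨ i = 3 ∨ j = -1 ∨ j = 3) →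
      bx i j ∈ C.support) :
    meshVertices (dom C 1) 1 = boxSites ![0, 0] ![2, 2] := by
  ext x
  rw [mem_meshVertices_iff, mem_boxSites_iff, Fin.forall_fin_two]
  simp only [Matrix.cons_val_zero, Matrix.cons_val_one]
  constructor
  · intro hx
    by_contra hbox
    by_cases hR : pt x ∈ {z : ℂ | (-1 ≤ z.re ∧ z.re ≤ 3) ∧ (-1 ≤ z.im ∧ z.im ≤ 3)}
    · obtain ⟨⟨h1, h2⟩, h3, h4⟩ := hR
      simp only [pt_re, pt_im] at h1 h2 h3 h4
      have i1 : -1 ≤ x 0 := by exact_mod_cast h1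
      have i2 : x 0 ≤ 3 := by exact_mod_cast h2
      have i3 : -1 ≤ x 1 := by exact_mod_cast h3
      have i4 : x 1 ≤ 3 := by exact_mod_cast h4
      have hb : x 0 = -1 ∨ x 0 = 3 ∨ x 1 = -1 ∨ x 1 = 3 := by omega
      have hxC := hmem (x 0) (x 1) i1 i2 i3 i4 hb
      rw [← eq_bx x] at hxC
      exact notMem_dom_of_mem_support C 1 hxC hx
    · refine not_mem_dom_of_not_mem_Rcl₃ C hbx hR ?_
      rwa [LeftRightFKG.Negative.meshPoint_one] at hx
  · rintro ⟨⟨h1, h2⟩, h3, h4⟩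
    rw [LeftRightFKG.Negative.meshPoint_one]
    apply Rint₃_subset_dom C hpc hle hbd
    simp only [mem_setOf_eq, pt_re, pt_im]
    have i1 : (0 : ℝ) ≤ x 0 := by exact_mod_cast h1
    have i2 : (x 0 : ℝ) ≤ 2 := by exact_mod_cast h2
    have i3 : (0 : ℝ) ≤ x 1 := by exact_mod_cast h3
    have i4 : (x 1 : ℝ) ≤ 2 := by exact_mod_cast h4
    refine ⟨⟨by linarith, by linarith⟩, by linarith, by linarith⟩

end Cycle

/-- **Stub `stub_windBox`** (crux `NotFKGAtOne`, line `three-by-three-corner-witness`): for any closed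
walk `C` of `ℤ²` at `c₀ = (-1,-1)` tracing the boundary cycle of `[-1,3]²`, the open square `(-1,3)²`
lies in `Ω(C) = {wind(C, ·) ≠ 0}` and the mesh-`1` vertices of `Ω(C)` are exactly the box `{0,1,2}²`
(the five hypotheses of the section `Cycle` hold for the explicit cycle by `decide`). [folklore] -/
theorem stub_windBox :
    ∀ C : (zdGraph 2).Walk c₀ c₀, C.support.tail =
        [bx 0 (-1), bx 1 (-1), bx 2 (-1), bx 3 (-1), bx 3 0, bx 3 1, bx 3 2, bx 3 3,
        bx 2 3, bx 1 3, bx 0 3, bx (-1) 3, bx (-1) 2, bx (-1) 1, bx (-1) 0, c₀] →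
      {z : ℂ | (-1 < z.re ∧ z.re < 3) ∧ (-1 < z.im ∧ z.im < 3)} ⊆ dom C 1 ∧
        meshVertices (dom C 1) 1 = boxSites ![0, 0] ![2, 2] := by
  intro C hC
  have hpc : pathCross 0 0 c₀ C.support.tail = -1 := by rw [hC]; decide
  have hle : ∀ x ∈ C.support.tail, x 1 ≤ 3 := by rw [hC]; decide
  have hbd : List.IsChain (fun p q : Site 2 => (p 1 = -1 ∧ q 1 = -1) ∨ (p 0 = 3 ∧ q 0 = 3) ∨
      (p 1 = 3 ∧ q 1 = 3) ∨ (p 0 = -1 ∧ q 0 = -1)) (c₀ :: C.support.tail) := by rw [hC]; decide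
  have hbx : ∀ x ∈ C.support.tail, (-1 ≤ x 0 ∧ x 0 ≤ 3) ∧ (-1 ≤ x 1 ∧ x 1 ≤ 3) := by rw [hC]; decide
  have hmem : ∀ i j : ℤ, -1 ≤ i → i ≤ 3 → -1 ≤ j → j ≤ 3 → (i = -1 ∨ i = 3 ∨ j = -1 ∨ j = 3) →
      bx i j ∈ C.support := by
    intro i j hi hi' hj hj' hb
    rw [← C.cons_tail_support, hC]
    interval_cases i <;> interval_cases j <;> first | decide | (exfalso; omega)
  exact ⟨Rint₃_subset_dom C hpc hle hbd, meshVertices_dom C hpc hle hbd hbx hmem⟩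

end Summit.CriticalPhenomena.SAWScalingLimit.Theorems.NotFKGAtOne

end
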